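import Summits.QuantumFields.YangMills.Theorems.UnitScaleTiltProp7BondAvgIterCoercivity
import Summits.QuantumFields.YangMills.Theorems.UnitScaleTiltProp7CovariantCoercivity
import Literature.MathematicalPhysics.QuantumFieldTheory.Balaban1983to89.T4Continuum
import HarnessLib

/-!
# K0⁷ STUB 1 (`stub_prop8StepCoP13`), sub-target S4a file 3: **THE POSITIVITY INPUT `hpos` OF THE CRITICAL-POINT EQUATION (128) ⟹ (143) READ AT NODE 00's
# RECORD OBJECTS** — the flat ([B5] Prop. 1.1 (1.90)) and small-field covariant ([B9] Thm 3.11's mechanism) `L²` coercivity of the linearised Wilson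
# Hessian on the kernel of the straight-line `k`-fold block averaging, at the fine torus `Site (F.P K) 0` of a 𝕋⁴-family member, `k ≤ m + K` levels,
# `d = 4`, every `N` — UST's generic theorems BY NAME

Cell `pub-ymgap`, width seat `pub-ymgap-k0-s1-w1` g0 (plan g77 W-SEAT-START-LIST v3 §k0-s1; dag-lead TABLE row n07: «first missing estimate = [15] Prop 8's
curvature∕positivity step»).  `--kind proof --supports stmt-QuantumFields-20541 --as helper`; count-neutral.  Companion of this seat's
`…K0Stub1CriticalEquation143CoordFree` (whose hypothesis `hpos : ∀ z ∈ T, z ≠ 0 → 0 < ⟨z, Δ_a z⟩` this file feeds at the flat ∕ small-field background,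
one level, in UST letters) and `…K0Stub1FlatSmallSolution158AtRecord`.

WHY.  [15] Sect. F's contraction (158) and the derivation (127) ⟹ (143) use that `Δ_a = Δ(U₀) + DRD* + aQ*Q` is positive on the tangent space
([Balaban1985BackgroundPropagators] Thm 3.11; flat core [Balaban1984PropagatorsI] Prop. 1.1 (1.90) «Δ_a = G⁻¹ ≥ γ₀(Δ + I) … γ₀ independent of k, T_η,
depending on d only»).  The route `UnitScaleTilt` (cell ym3-torus) PROVED the `L²` core of both GENERICALLY over `P : Params` and levels `i, i′, e` with
`sitesPerDir i = L^e·sitesPerDir i′`: `Prop7FlatCoercivity.sum_sq_le_lineBlockAvg_add_grad` ∕ `Prop7FlatCoercivity.curl_sq_ge_of_landau_of_avg_zero` (file `UnitScaleTiltProp7FlatHodgeCoercivity`)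
(flat: `(8∕17)(L^e)⁻²‖X‖² ≤ ‖∂X‖²` on Landau fields with zero straight-line `e`-fold block averages) and `Prop7CovariantCoercivity.
sum_normSq_le_covGrad_of_covLineAvg_eq_zero` (covariant, `SU(N)` background with plaquette variables within `εL^{−2e}` of `1`, `N d³ε² ≤ ½`).  Their
`_T3` twins read them at the d = 3 carrier.  THIS FILE reads them at the RECORD: `P := F.P K` of a `T4Family` member, fine level `i = 0`, `e = k`
averaging levels (`k ≤ m + K`, the standing range of the K0 row: `Prop8RegSepTopStep` binds `K k`), `i′ = k`, `d = 4` (`T4Family.P_d` rfl), so the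
covariant smallness reads `128·N·ε² ≤ 1` (`N = 2`: `256ε² ≤ 1`); the tower identity `(F.P K).sitesPerDir 0 = L^k·(F.P K).sitesPerDir k` (`k ≤ m + K`)
is UST's `Prop7FlatCoercivity.sitesPerDir_zero_eq_pow_mul` at `P := F.P K` (cited, not re-declared).

WHAT IS PROVED (sorry-free; no definition; axioms standard; every proof = the UST theorem BY NAME).
* §1 FLAT: `sum_sq_le_lineBlockAvg_add_grad_T4` ((1.90) gradient form: `‖X‖² ≤ 2L^{4k}‖M_kX‖² + (17∕8)L^{2k}‖∇X‖²`), `sum_sq_le_lineBlockAvg_add_curl_add_diverg_T4`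
  (Hodge form), ★ `curl_sq_ge_of_landau_of_avg_zero_T4` (`∂*X = 0`, `M_kX = 0` ⇒ `(8∕17)L^{−2k}‖X‖² ≤ Σ_p (∂X)(p)²`); and the same in the tree's vocabulary
  of record `Q_k = LatticeFieldCalculus.bondAvgIter k` ([B5] (1.18), UST `bondAvgIter_eq_lineBlockAvg`): `sum_sq_le_bondAvgIter_add_curl_add_diverg_T4`,
  ★ `curl_sq_ge_of_landau_of_bondAvgIter_eq_zero_T4` (`∂*X = 0`, `Q_kX = 0` ⇒ `(8∕17)L^{−2k}‖X‖² ≤ Σ_p (∂X)(p)²`).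
* §2 SMALL FIELD, COVARIANT: ★ `sum_normSq_le_covGrad_of_covLineAvg_eq_zero_T4` (`SU(N)` background `U₀` on `Site (F.P K) 0` with `dist1(U₀(∂p)) ≤ εL^{−2k}`,
  `128Nε² ≤ 1`, covariant straight-line averages of `Y` zero ⇒ `L^{−2k}Σ_b‖Y(b)‖² ≤ (9N∕2)Σ_bΣ_ν‖(∇^{U₀}_νY)(b)‖²`), `sum_normSq_le_covLineAvg_add_covGrad_su_T4`
  (the full inequality without the kernel hypothesis).
HONEST SCOPE.  (i) UST letters: the straight-line average `M_k` ∕ its covariant twin `A^{U₀}` (written out as explicit sums), the unit-lattice `curl 1` ∕ `diverg 1`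
of `LatticeFieldCalculus`, the comb-transported covariant gradient; the identification of `M_k` ∕ `A^{U₀}` with the linearisation of the record's (0.4) descent
`avOfRecord F N K` (= `blockAvg expMeanLogSU`) is UST `Prop7IterLinearisationFlat` ∕ `Prop7AvgTrueLinearisation` at one level and is NOT read here; the
multi-scale tangent space of `genSet s.Ω k` (levels `1 … k` on the territories `Γ_j`) and the cube sequence (144) with boundary conditions are NOT treated
(one level, whole torus).  (ii) Print's operator has `∂R(1)∂*` with the residual projection `R` (Hodge step [B5] p. 30) — not the full `∂∂*`; S1 (dag-n07-w1)
owns `Δ^η(1)`, `R`, `Q_k` at the record and the junction with these letters.  (iii) Nothing of Bałaban asserted; `stub_prop8StepCoP13` ∕ K0⁷ NOT closed; N07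
NOT discharged; counts unmoved (28∕28 · 5∕27); one finite 𝕋⁴ programme at fixed ε — R4 closes the conditional finite-𝕋⁴ rung `BalabanLadder.UV` only,
never the summit; the YM mass gap (Clay) is NOT proved by any of this; nothing continuum ∕ ℝ⁴ ∕ OS.  No `sorry`, no `def`, no `instance`, no `notation`.

References: T. Bałaban, CMP **95** (1984) 17–40 [Balaban1984PropagatorsI] Prop. 1.1 (1.90) p.33, (1.21) p.21, (1.69)–(1.72) pp.29–30; CMP **99** (1985) 389–434
[Balaban1985BackgroundPropagators] Thm 3.11 p.416; CMP **102** (1985) 277–309 [Balaban1985Variational] (128)–(131) p.298, Prop. 7 p.299, (158) p.302;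
CMP **109** (1987) [Balaban1987RG1] (0.1) p.251.

v1.1 (g2, 2026-08-28; DOCSTRINGS ONLY — every declaration, statement and proof byte-identical to v1 p585467): ref-O g2 READ-29 NITs — NIT-1 the UST namespace is
`Prop7FlatCoercivity` (the lemmas live in the FILES `UnitScaleTiltProp7Flat{,Hodge,BondAvgIter}Coercivity`); NIT-2 [B5] (1.69) is on p.29 ((1.69)–(1.72) pp.29–30); NIT-3∕A6 the
adjointness step `Σ_p (∂X)(p)² = ⟨X, ∂*∂X⟩` feeding READ-28's `0 < ⟨z, Δz⟩` is this seat's g2 file `BalabanUVNodesK0Stub1FlatHessianLandauCoercivityAtRecord` (p593232: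
`inner_hessOpAt_one_self_eq_sum_curl_normSq`, `hessOpAt_one_pos_of_le_landau_ker_T4`) on S1's carrier.
-/

noncomputable section

open scoped BigOperators Matrix.Norms.L2Operator

namespace Summit.QuantumFields.YangMills.Theorems.K0Stub1FlatCoercivityAtRecord

open Literature.MathematicalPhysics.QuantumFieldTheory.Balaban1983to89
open Literature.MathematicalPhysics.QuantumFieldTheory.Balaban1983to89.T4Continuum (T4Family)
open Finset LatticeFieldCalculus B1RG242Torus
open B7Prop1Explicit (treeWord)
open B7Eq78Linearization (conjR)
open B10Eq27TorusAxialLog (holT unitsField toUField)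
open Summit.QuantumFields.YangMills.Theorems.Prop7FlatCoercivity (sum_sq_le_lineBlockAvg_add_grad sum_sq_le_lineBlockAvg_add_curl_add_diverg
  curl_sq_ge_of_landau_of_avg_zero sitesPerDir_zero_eq_pow_mul sum_sq_le_bondAvgIter_add_curl_add_diverg curl_sq_ge_of_landau_of_bondAvgIter_eq_zero)
open Summit.QuantumFields.YangMills.Theorems.Prop7CovariantCoercivity (sum_normSq_le_covGrad_of_covLineAvg_eq_zero hyp_of_specialUnitary
  sum_normSq_le_covLineAvg_add_covGrad_su)

/-! ## §0  The record's tower: `|T^{(0)}| = L^k·|T^{(k)}|` per direction for `k ≤ m + K` is UST `Prop7FlatCoercivity.sitesPerDir_zero_eq_pow_mul`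
at `P := F.P K` (`(F.P K).m = F.m`, `(F.P K).K = K` by `rfl`); used below, not re-declared. -/

/-- The standing range of the K0 row read on the record's `Params`: `k ≤ F.m + K` is `k ≤ (F.P K).m + (F.P K).K`. [cite: Balaban1987RG1, (0.1) p.251 (bookkeeping)] -/
theorem le_m_add_K (F : T4Family) (K k : ℕ) (hk : k ≤ F.m + K) : k ≤ (F.P K).m + (F.P K).K := hk

/-! ## §1  FLAT: [B5] Prop. 1.1 (1.90) at the record's fine torus, `k`-uniform -/

/-- **THE FLAT COERCIVITY, GRADIENT FORM, AT THE RECORD** (fine torus `Site (F.P K) 0`, `k ≤ m + K` averaging levels): for every real bond field `X`,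
`Σ_b X(b)² ≤ 2L^{4k}·Σ_c (M_kX)(c)² + (17∕8)L^{2k}·Σ_b Σ_ν (X(b+e_ν) − X(b))²` — `M_k` the straight-line `k`-fold block average (written out), constants
independent of `m`, `K`, `k`.  UST `Prop7FlatCoercivity.sum_sq_le_lineBlockAvg_add_grad` at the record tower. [cite: Balaban1984PropagatorsI, Prop. 1.1 (1.90) p.33] -/
theorem sum_sq_le_lineBlockAvg_add_grad_T4 (F : T4Family) (K k : ℕ) (hk : k ≤ F.m + K) (X : PBond (F.P K) 0 → ℝ) :
    ∑ b : PBond (F.P K) 0, X b ^ 2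
      ≤ 2 * (((F.P K).L : ℝ) ^ k) ^ (F.P K).d * ∑ c : PBond (F.P K) k,
            (((((F.P K).L : ℝ) ^ k) ^ (F.P K).d * ((F.P K).L : ℝ) ^ k)⁻¹ *
              ∑ x ∈ univ.filter (fun x : Site (F.P K) 0 => Site.proj k k x = c.src),
                ∑ t ∈ range ((F.P K).L ^ k), X ⟨(fun z : Site (F.P K) 0 => z.shift c.dir)^[t] x, c.dir⟩) ^ 2
        + (17 / 8) * (((F.P K).L : ℝ) ^ k) ^ 2 *
          ∑ b : PBond (F.P K) 0, ∑ ν : Fin (F.P K).d, (X ⟨b.src.shift ν, b.dir⟩ - X b) ^ 2 :=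
  sum_sq_le_lineBlockAvg_add_grad (sitesPerDir_zero_eq_pow_mul (P := F.P K) (le_m_add_K F K k hk)) X

/-- **THE FLAT COERCIVITY, HODGE FORM, AT THE RECORD**: `Σ_b X(b)² ≤ 2L^{4k}·Σ_c (M_kX)(c)² + (17∕8)L^{2k}·(Σ_p (∂X)(p)² + Σ_x (∂*X)(x)²)` —
the quadratic form of `∂*∂ + ∂∂* + a·M_k*M_k` is bounded below by `(8∕17)L^{−2k}` ([B5] (1.69)∕(1.72) with the full divergence).  UST
`Prop7FlatCoercivity.sum_sq_le_lineBlockAvg_add_curl_add_diverg` (file `UnitScaleTiltProp7FlatHodgeCoercivity`) at the record tower. [cite: Balaban1984PropagatorsI, Prop. 1.1 (1.90) p.33, (1.21) p.21] -/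
theorem sum_sq_le_lineBlockAvg_add_curl_add_diverg_T4 (F : T4Family) (K k : ℕ) (hk : k ≤ F.m + K) (X : VecField (F.P K) 0 ℝ) :
    ∑ b : PBond (F.P K) 0, X b ^ 2
      ≤ 2 * (((F.P K).L : ℝ) ^ k) ^ (F.P K).d * ∑ c : PBond (F.P K) k,
            (((((F.P K).L : ℝ) ^ k) ^ (F.P K).d * ((F.P K).L : ℝ) ^ k)⁻¹ *
              ∑ x ∈ univ.filter (fun x : Site (F.P K) 0 => Site.proj k k x = c.src),
                ∑ t ∈ range ((F.P K).L ^ k), X ⟨(fun z : Site (F.P K) 0 => z.shift c.dir)^[t] x, c.dir⟩) ^ 2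
        + (17 / 8) * (((F.P K).L : ℝ) ^ k) ^ 2 *
          (∑ p : Plaq (F.P K) 0, (curl 1 X p) ^ 2 + ∑ x : Site (F.P K) 0, (diverg 1 X x) ^ 2) :=
  sum_sq_le_lineBlockAvg_add_curl_add_diverg (sitesPerDir_zero_eq_pow_mul (P := F.P K) (le_m_add_K F K k hk)) X

/-- ★ **THE FLAT LINEARISED WILSON HESSIAN IS `k`-UNIFORMLY COERCIVE ON THE TANGENT SPACE, AT THE RECORD** (Landau gauge `∂*X = 0`, vanishing
straight-line `k`-fold block averages): `(8∕17)·L^{−2k}·Σ_b X(b)² ≤ Σ_p (∂X)(p)²` on the fine torus of run `K`, uniformly in `m`, `K`, `k ≤ m + K` — the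
flat `hpos` of `…K0Stub1CriticalEquation143CoordFree.eq143_of_critical128` for `Δ = ` the curl form and `T = ker M_k ∩ ker ∂*`, in UST letters.
UST `Prop7FlatCoercivity.curl_sq_ge_of_landau_of_avg_zero` (file `UnitScaleTiltProp7FlatHodgeCoercivity`) at the record tower. [cite: Balaban1984PropagatorsI, Prop. 1.1 (1.90) p.33; Balaban1985Variational, (128)–(131) p.298] -/
theorem curl_sq_ge_of_landau_of_avg_zero_T4 (F : T4Family) (K k : ℕ) (hk : k ≤ F.m + K) (X : VecField (F.P K) 0 ℝ)
    (hdiv : ∀ x : Site (F.P K) 0, diverg 1 X x = 0)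
    (havg : ∀ c : PBond (F.P K) k, ∑ x ∈ univ.filter (fun x : Site (F.P K) 0 => Site.proj k k x = c.src),
      ∑ t ∈ range ((F.P K).L ^ k), X ⟨(fun z : Site (F.P K) 0 => z.shift c.dir)^[t] x, c.dir⟩ = 0) :
    (8 / 17) * (((F.L : ℝ) ^ k) ^ 2)⁻¹ * ∑ b : PBond (F.P K) 0, X b ^ 2 ≤ ∑ p : Plaq (F.P K) 0, (curl 1 X p) ^ 2 :=
  curl_sq_ge_of_landau_of_avg_zero (sitesPerDir_zero_eq_pow_mul (P := F.P K) (le_m_add_K F K k hk)) X hdiv havg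

/-- **THE FLAT COERCIVITY, HODGE FORM, FOR THE ITERATED LINEAR AVERAGE `Q_k` OF RECORD, AT THE RECORD** (`Q_k = LatticeFieldCalculus.bondAvgIter k`,
[B5] (1.11)∕(1.18) — the `k`-fold composition of the one-step linear bond averages, = the straight-line average by UST `bondAvgIter_eq_lineBlockAvg`):
`Σ_b X(b)² ≤ 2L^{4k}·Σ_c (Q_kX)(c)² + (17∕8)L^{2k}·(Σ_p (∂X)(p)² + Σ_x (∂*X)(x)²)`.  UST `Prop7FlatCoercivity.sum_sq_le_bondAvgIter_add_curl_add_diverg` at `P := F.P K`.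
[cite: Balaban1984PropagatorsI, (1.18) p.20, Prop. 1.1 (1.90) p.33] -/
theorem sum_sq_le_bondAvgIter_add_curl_add_diverg_T4 (F : T4Family) (K k : ℕ) (hk : k ≤ F.m + K) (X : VecField (F.P K) 0 ℝ) :
    ∑ b : PBond (F.P K) 0, X b ^ 2
      ≤ 2 * (((F.P K).L : ℝ) ^ k) ^ (F.P K).d * ∑ c : PBond (F.P K) k, bondAvgIter k X c ^ 2
        + (17 / 8) * (((F.P K).L : ℝ) ^ k) ^ 2 * (∑ p : Plaq (F.P K) 0, (curl 1 X p) ^ 2 + ∑ x : Site (F.P K) 0, (diverg 1 X x) ^ 2) :=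
  sum_sq_le_bondAvgIter_add_curl_add_diverg (P := F.P K) (le_m_add_K F K k hk) X

/-- ★ **[B9] THM 3.11 AT THE FLAT BACKGROUND, `L²` FORM, ON `ker Q_k` IN THE LANDAU GAUGE, AT THE RECORD** (fine torus `Site (F.P K) 0`, `k ≤ m + K`): if
`∂*X = 0` and `Q_kX = 0` (`Q_k = bondAvgIter k`, the linearisation at `U ≡ 1` of the `k`-fold linear bond averaging — the flat tangent space of the one-scale
pin in the tree's vocabulary), then `(8∕17)·L^{−2k}·Σ_b X(b)² ≤ Σ_p (∂X)(p)²`, uniformly in `m`, `K`, `k` — the flat `hpos` for the record's `Q_k`.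
UST `Prop7FlatCoercivity.curl_sq_ge_of_landau_of_bondAvgIter_eq_zero` at `P := F.P K`. [cite: Balaban1985BackgroundPropagators, Thm 3.11 p.416; Balaban1984PropagatorsI, Prop. 1.1 (1.90) p.33] -/
theorem curl_sq_ge_of_landau_of_bondAvgIter_eq_zero_T4 (F : T4Family) (K k : ℕ) (hk : k ≤ F.m + K) (X : VecField (F.P K) 0 ℝ)
    (hdiv : ∀ x : Site (F.P K) 0, diverg 1 X x = 0) (havg : ∀ c : PBond (F.P K) k, bondAvgIter k X c = 0) :
    (8 / 17) * (((F.L : ℝ) ^ k) ^ 2)⁻¹ * ∑ b : PBond (F.P K) 0, X b ^ 2 ≤ ∑ p : Plaq (F.P K) 0, (curl 1 X p) ^ 2 :=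
  curl_sq_ge_of_landau_of_bondAvgIter_eq_zero (P := F.P K) (le_m_add_K F K k hk) X hdiv havg

/-! ## §2  SMALL FIELD, COVARIANT: [B9] Thm 3.11's mechanism at the record's fine torus, `k`-uniform -/

variable {N : ℕ} [NeZero N]

/-- **THE COVARIANT COERCIVITY FOR AN `SU(N)` BACKGROUND WITH SMALL PLAQUETTE VARIABLES, AT THE RECORD** (`dist1 (U₀(∂p)) ≤ a` for all fine plaquettes;
`SU(N)` read in `M_N(ℂ)` through `unitsField ∘ toUField`): `Σ_b‖Y(b)‖² ≤ 2N·(L^{4k}L^{2k})⁻¹·Σ_c‖A^{U₀}_cY‖² + (9N∕4)L^{2k}·Σ_bΣ_ν‖(∇^{U₀}_νY)(b)‖² +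
N·4³·(L^{2k}a)²·Σ_b‖Y(b)‖²`, `A^{U₀}` the covariant straight-line block average (comb transport to the block corner), `∇^{U₀}` the covariant gradient.
UST `Prop7CovariantCoercivity.sum_normSq_le_covLineAvg_add_covGrad_su` at the record tower. [cite: Balaban1985BackgroundPropagators, Thm 3.11 p.416] -/
theorem sum_normSq_le_covLineAvg_add_covGrad_su_T4 (F : T4Family) (K k : ℕ) (hk : k ≤ F.m + K)
    (U₀ : GaugeField (F.P K) 0 (Matrix.specialUnitaryGroup (Fin N) ℂ)) {a : ℝ} (ha : 0 ≤ a)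
    (hU : ∀ p : Plaq (F.P K) 0, dist1 (GaugeField.plaqHol U₀ p) ≤ a) (Y : PBond (F.P K) 0 → Matrix (Fin N) (Fin N) ℂ) :
    ∑ b : PBond (F.P K) 0, ‖Y b‖ ^ 2
      ≤ 2 * N * (((((F.P K).L : ℝ) ^ k) ^ (F.P K).d) * (((F.P K).L : ℝ) ^ k) ^ 2)⁻¹ *
          ∑ c : PBond (F.P K) k, ‖∑ r : Fin (F.P K).d → Fin ((F.P K).L ^ k), ∑ t ∈ range ((F.P K).L ^ k),
              conjR (holT (unitsField (toUField U₀)) (Site.fibreSite 0 k c.src fun _ => ⟨0, pow_pos (F.P K).L_pos k⟩)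
                  (treeWord fun ν => ((r ν : ℕ) : ℤ))
                  * holT (unitsField (toUField U₀)) (Site.fibreSite 0 k c.src r) (List.replicate t (c.dir, true)))
                (Y ⟨(fun z : Site (F.P K) 0 => z.shift c.dir)^[t] (Site.fibreSite 0 k c.src r), c.dir⟩)‖ ^ 2
        + (9 * N / 4) * (((F.P K).L : ℝ) ^ k) ^ 2 *
            ∑ b : PBond (F.P K) 0, ∑ ν : Fin (F.P K).d, ‖conjR (unitsField (toUField U₀) ⟨b.src, ν⟩) (Y ⟨b.src.shift ν, b.dir⟩) - Y b‖ ^ 2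
        + N * (F.P K).d ^ 3 * ((((F.P K).L : ℝ) ^ k) ^ 2 * a) ^ 2 * ∑ b : PBond (F.P K) 0, ‖Y b‖ ^ 2 :=
  sum_normSq_le_covLineAvg_add_covGrad_su U₀ ha hU (sitesPerDir_zero_eq_pow_mul (P := F.P K) (le_m_add_K F K k hk)) Y

/-- ★ **THE SMALL-FIELD COVARIANT COERCIVITY ON THE KERNEL OF THE COVARIANT AVERAGING, AT THE RECORD** (`SU(N)` configurations on the fine torus
`Site (F.P K) 0`, `k ≤ m + K` averaging levels; background `U₀` with `dist1 (U₀(∂p)) ≤ ε·L^{−2k}` — the plaquette clause of print's (6)∕(14), non-strict):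
if the covariant straight-line `k`-fold block averages of `Y` vanish, then `L^{−2k}·Σ_b‖Y(b)‖² ≤ (9N∕2)·Σ_b Σ_ν ‖(∇^{U₀}_νY)(b)‖²` as soon as `128·N·ε² ≤ 1`
(`d = 4`: `N·4³·ε² ≤ ½`; `N = 2`: `256ε² ≤ 1`) — uniformly in `m`, `K`, `k`.  The small-field `hpos` of the record's Sect.-F chain in UST letters.
UST `Prop7CovariantCoercivity.sum_normSq_le_covGrad_of_covLineAvg_eq_zero` at the record tower.
[cite: Balaban1985BackgroundPropagators, Thm 3.11 p.416; Balaban1985Variational, (14) p.280, (128) p.298] -/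
theorem sum_normSq_le_covGrad_of_covLineAvg_eq_zero_T4 (F : T4Family) (K k : ℕ) (hk : k ≤ F.m + K)
    (U₀ : GaugeField (F.P K) 0 (Matrix.specialUnitaryGroup (Fin N) ℂ)) {ε : ℝ} (hε : 0 ≤ ε) (hε1 : 128 * N * ε ^ 2 ≤ 1)
    (hU : ∀ p : Plaq (F.P K) 0, dist1 (GaugeField.plaqHol U₀ p) ≤ ε * (((F.L : ℝ) ^ k) ^ 2)⁻¹)
    (Y : PBond (F.P K) 0 → Matrix (Fin N) (Fin N) ℂ)
    (havg : ∀ c : PBond (F.P K) k, ∑ r : Fin (F.P K).d → Fin ((F.P K).L ^ k), ∑ t ∈ range ((F.P K).L ^ k),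
        conjR (holT (unitsField (toUField U₀)) (Site.fibreSite 0 k c.src fun _ => ⟨0, pow_pos (F.P K).L_pos k⟩)
              (treeWord fun ν => ((r ν : ℕ) : ℤ))
            * holT (unitsField (toUField U₀)) (Site.fibreSite 0 k c.src r) (List.replicate t (c.dir, true)))
          (Y ⟨(fun z : Site (F.P K) 0 => z.shift c.dir)^[t] (Site.fibreSite 0 k c.src r), c.dir⟩) = 0) :
    (((F.L : ℝ) ^ k) ^ 2)⁻¹ * ∑ b : PBond (F.P K) 0, ‖Y b‖ ^ 2
      ≤ (9 * N / 2) * ∑ b : PBond (F.P K) 0, ∑ ν : Fin (F.P K).d,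
          ‖conjR (unitsField (toUField U₀) ⟨b.src, ν⟩) (Y ⟨b.src.shift ν, b.dir⟩) - Y b‖ ^ 2 := by
  obtain ⟨hV, hplaq⟩ := hyp_of_specialUnitary U₀ hU
  have hLF : ((F.P K).L : ℝ) = (F.L : ℝ) := by norm_cast
  have hd : ((F.P K).d : ℝ) = 4 := by norm_num [T4Family.P_d]
  have hL0 : (0 : ℝ) < ((F.L : ℝ) ^ k) ^ 2 := by
    have : (0 : ℝ) < F.L := by have := F.hL.2; exact_mod_cast (by omega : 0 < F.L)
    positivity
  have hN0 : (0 : ℝ) ≤ (N : ℝ) := Nat.cast_nonneg _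
  have hsmall : (N : ℝ) * (F.P K).d ^ 3 * ((((F.P K).L : ℝ) ^ k) ^ 2 * (ε * (((F.L : ℝ) ^ k) ^ 2)⁻¹)) ^ 2 ≤ 1 / 2 := by
    rw [hLF, hd]
    have e1 : ((F.L : ℝ) ^ k) ^ 2 * (ε * (((F.L : ℝ) ^ k) ^ 2)⁻¹) = ε := by
      rw [mul_comm ε, ← mul_assoc, mul_inv_cancel₀ hL0.ne', one_mul]
    rw [e1]
    nlinarith [hε1, hN0, sq_nonneg ε]
  have h := sum_normSq_le_covGrad_of_covLineAvg_eq_zero hV (by positivity) hplaq hsmall (sitesPerDir_zero_eq_pow_mul (P := F.P K) (le_m_add_K F K k hk)) Y havg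
  rw [hLF] at h
  exact h

end Summit.QuantumFields.YangMills.Theorems.K0Stub1FlatCoercivityAtRecord

end
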